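/-
Copyright: cell pub-balaban-gaps, seat ne8 (estimate NE7c), gens 13–14. Project licence.
-/
import Summits.QuantumFields.BalabanUV.T4Continuum.Spine.NE7b.CreationLedgerPowerCounting
import Summits.QuantumFields.BalabanUV.T4Continuum.Spine.NE7b.CompactFibreCreationFloor

/-!
# Road (δ) on the creation ledger in print's POWER-COUNTING regime (ne6's V28) and on print's (1.77)∕(1.78) floor (V24 §2): print's
# exponent condition «`2p₁ − (d+5)r₀ > p₀`» carries the LIVE ledger with the SAME exponents — only the one largeness row moves,
# `K ↦ K + C_n·(3∕2)log ν₀⁻¹`, `c_S ↦ λ₀²c_S`, i.e. ONE threshold `ℓ⋆(λ₀, ν₀)` — and at a live event the `p₁²`-power is scaled by `λ₀²`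
# while (1.77)'s `O(1)` constant is not (row NE7c; junction J-14, companion of file 27 `LiveFactorWindowRate`)

Cell `pub-balaban-gaps` (G2), seat ne8, estimate **NE7c** (`T4IndicatorShell.ShellWeightBound`; two-run artefact, NOT PRINTED in
[Bałaban 1983–89], NOT PROVED).  Twenty-eighth proof-only file under `Spine/NE7c/`: seat ne6's census files V28
`Spine/NE7b/CreationLedgerPowerCounting` (GEN 14; Mathlib-only: the creation ledger with letters growing as powers of `ℓ = log g_k⁻²`) and V24
`Spine/NE7b/CompactFibreCreationFloor` §2 (GEN 13; the (n)-carrier's price with print's (1.77)∕(1.78) floor) consumed BY NAME at road (δ)'s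
live letters; imports those two files only.  Nothing of Bałaban's is named; no `def`; 0 `sorry`.

THE QUESTION (seat census `HOME/ne/NE7c.md` §20, row 47 (iii)∕(iv) = row 46 BY VALUE).  File 26 (`LiveFactorCreationPrice`) and file 27
(`LiveFactorWindowRate` §3) display the creation step's LIVE ledger — `P + i₀ + #bonds·(rate·log η⁻¹ + const) + #bonds·rate·log ν₀⁻¹ ≤
λ₀²·(λ∕2)δ′²` (rate `2` ∕ `3∕2`) — and certify it «eventually» along print's flow at FIXED bond count.  V28 models print's regime
([Balaban1989LargeFieldII] p. 383, after (1.78)): the bond count `≤ C_n·ℓ^{4r₀}` and the window letter `≤ (3∕2)ℓ + c` grow as powers of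
`ℓ`, the floor is `c_S·ℓ^{2p₁ − 6r₀}`, and print's «We assume that `2p₁ − (d + 5)r₀ > p₀`» supplies the margins.  (a) Does that condition still
carry the ledger at live letters, and with which exponents?  (b) In print's letters the floor is (1.77)∕(1.78)'s `γ₀W⁻¹(A₁p₁)² − c`
(V24 §2): what exactly does the live factor scale?

WHAT IS PROVED ([folklore]; ne6's theorems BY NAME at `c := c + (3∕2)log ν₀⁻¹`, `c_S := λ₀²c_S`, `A₁ := s·A₁`, plus real arithmetic):
* §1 V28's POWER-COUNTING LEDGER AT LIVE LETTERS — answer to (a): **`creation_ledger_print_regime_live`** = V28's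
  `creation_ledger_print_regime` at `c := c + (3∕2)log ν₀⁻¹`, `c_S := λ₀²c_S`: under print's «`2p₁ − 9r₀ > p₀`» (`d = 4`) and the LIVE
  largeness row `1 + I₀ + C_n·(3∕2 + c + (3∕2)log ν₀⁻¹) ≤ λ₀²c_S·ℓ^{r₀}`,
  `ℓ^{p₀} + I₀ + C_n·ℓ^{4r₀}·((3∕2)ℓ + c + (3∕2)log ν₀⁻¹) ≤ λ₀²c_S·ℓ^{2p₁ − 6r₀}` — the SAME exponents `p₀, 4r₀, 2p₁ − 6r₀` and margin `r₀`:
  the live factor never enters the power counting; `creation_ledger_print_regime_live_of_le`: the row holds for every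
  `ℓ ≥ max(1, ((1 + I₀ + C_n(3∕2 + c + (3∕2)log ν₀⁻¹))∕(λ₀²c_S))^{1∕r₀})` — ONE `g⋆(λ₀, ν₀)`, `k`-uniform; `threshold_live_ge`: that live
  threshold is `≥` the dead one `(K∕c_S)^{1∕r₀}` («`g_k` small» gets smaller, nothing else); and the junction BY VALUE
  **`liveLedger_of_powerCounting`**: under the dictionary `P ≤ ℓ^{p₀}`, `i₀ ≤ I₀`, `0 ≤ #bonds ≤ C_nℓ^{4r₀}`, `log η⁻¹ ≤ ℓ` (window radius
  `≥ g_k`), `log 160 ≤ c`, floor `c_S·ℓ^{2p₁−6r₀} ≤ (λ∕2)δ′²`, the §1 row IMPLIES file 27's live ledger hypothesis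
  `P + i₀ + n·((3∕2)log η⁻¹ + log 160) + n·(3∕2)log ν₀⁻¹ ≤ λ₀²·(λ∕2)δ′²` — so files 26∕27's «eventually» is an explicit `ℓ⋆(λ₀, ν₀)` in
  print's regime (**`liveLedger_of_powerCounting_of_le`**).
* §1b (v1.2) V28 §4's ledger AT ANY RATE `r ≥ 0` and its `SU(N)` instance `r = (N² − 1)∕2` at live letters —
  `creation_ledger_print_regime_rate_live(_of_le)`, **`creation_ledger_print_regime_SUN_live`**: `c ↦ c + r·log ν₀⁻¹`, `c_S ↦ λ₀²c_S`, the
  SAME exponents; for every `N` the live factor is ONE moved largeness row `ℓ⋆(λ₀, ν₀; r)`.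
* §2 PRINT'S (1.77)∕(1.78) FLOOR AT A LIVE EVENT (V24 §2 BY NAME) — answer to (b): `print_exponent_live_le`,
  **`relFibre_moment_le_of_ineq177_178_live`** — with the large bond at the LOWERED threshold «`|B(b)| ≥ s·A₁p₁(g_j)`», `s ≥ λ₀`, the price is
  `e^{i₀ + c − λ₀²·γ₀W⁻¹(A₁p₁)²}·(∫F dκ ∕ κ(W))` for every `s`: the live factor multiplies print's `p₁²`-power ONLY — (1.77)'s `O(1)` constant
  `c` is threshold-free and is NOT scaled.
* §3 sanity: a decided instance of §1.

CENSUS (row 47 (iii)∕(iv), NEW; `HOME/ne/NE7c.md` §20): row 46 BY VALUE in print's power-counting regime — print's exponent condition carries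
the live ledger with the SAME exponents; the live factor enters the ONE largeness row as `K ↦ K + C_n·(3∕2)log ν₀⁻¹`, `c_S ↦ λ₀²c_S` ⟹
threshold `ℓ⋆(λ₀, ν₀)` — one `g⋆(λ₀)` as in file 5's `roadDelta_clauses_of_g_small`, NO clause on `λ₀`; (1.77)'s `O(1)` constant is not
scaled (it joins the excess `i₀`).  MILD.  Identical under (δ-1) and (δ-global…) (single-level letters).  BY-NAME EFFECT ON THE WALL: none
(junction ∕ census file).

NOT HERE (honest): which `p₀, p₁, r₀`, `γ₀` (GAPS G-B9-09), `W`, `C_n`, `c_S`, `I₀` Bałaban's step carries and that its creation-step carrier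
IS the (n)-carrier — ne6's (A3) ∕ (A1c) list applies verbatim (NC-NE7b-α UNRULED); in print the volume letter is paid by the counterterm
`E_k(Λ)`, not in the ledger (V28's honest remark) — the model row is stricter than print's sentence; node O; NE7c.  VERDICT WORD UNCHANGED:
WORK-bound behind node O; INSTANCE 0∕1.  NE7c ∕ NE7b NOT PRINTED ∕ NOT PROVED; spine 0∕9; one finite T⁴ — NOT ℝ⁴, NOT infinite volume, NOT
the mass gap, NOT Clay.
HONEST DEPENDENCY (cell): continuum YM on T⁴ ⇐ BetaPertH ∧ nine spine estimates (0∕9 proved); BetaPertH ⇐ (D1) ∧ (D4) ∧ CAP+tail.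
-/

set_option autoImplicit false

noncomputable section

open MeasureTheory Real Finset
open Summit.QuantumFields.BalabanUV.T4Continuum.NE7b.CreationLedgerPowerCounting
open Summit.QuantumFields.BalabanUV.T4Continuum.NE7b.CompactFibreCreationFloor (relFibre_moment_le_of_ineq177_178)

namespace Summit.QuantumFields.BalabanUV.T4Continuum.Spine.NE7c.LiveFactorCreationLedger

/-! ## §1 V28's power-counting ledger at live letters: the SAME exponents, one moved largeness row -/

/-- **THE CREATION LEDGER IN PRINT'S REGIME AT LIVE LETTERS** (`d = 4`, MODEL): V28's `creation_ledger_print_regime` with the volume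
letter's constant `c ↦ c + (3∕2)log ν₀⁻¹` (file 27 §1) and the floor constant `c_S ↦ λ₀²·c_S` (file 26 ∕ file 27 §3).  With `ℓ ≥ 1`, print's «`2p₁ − 9r₀ > p₀`»
([Balaban1989LargeFieldII] p. 383), the mild rows `0 ≤ r₀`, `2r₀ + 1 ≤ p₀`, constants `I₀, C_n, c ≥ 0`, `0 < ν₀ ≤ 1`, and the LIVE largeness
row `1 + I₀ + C_n·(3∕2 + (c + (3∕2)log ν₀⁻¹)) ≤ (λ₀²c_S)·ℓ^{r₀}`:
`ℓ^{p₀} + I₀ + C_n·ℓ^{4r₀}·((3∕2)ℓ + (c + (3∕2)log ν₀⁻¹)) ≤ (λ₀²c_S)·ℓ^{2p₁ − 6r₀}` — the SAME exponents and the SAME margin `r₀` as the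
dead row: the live factor never enters the power counting. [folklore] -/
theorem creation_ledger_print_regime_live {ℓ p₀ p₁ r₀ I₀ Cn c cS lam0 ν₀ : ℝ} (hℓ : 1 ≤ ℓ)
    (hprint : p₀ < 2 * p₁ - 9 * r₀) (hr : 0 ≤ r₀) (hp0 : 2 * r₀ + 1 ≤ p₀) (hI : 0 ≤ I₀) (hCn : 0 ≤ Cn) (hc : 0 ≤ c)
    (hν₀ : 0 < ν₀) (hν₀1 : ν₀ ≤ 1)
    (hK : 1 + I₀ + Cn * (3 / 2 + (c + 3 / 2 * Real.log ν₀⁻¹)) ≤ (lam0 ^ 2 * cS) * ℓ ^ r₀) :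
    ℓ ^ p₀ + I₀ + Cn * ℓ ^ (4 * r₀) * (3 / 2 * ℓ + (c + 3 / 2 * Real.log ν₀⁻¹)) ≤ (lam0 ^ 2 * cS) * ℓ ^ (2 * p₁ - 6 * r₀) := by
  have hlog : 0 ≤ Real.log ν₀⁻¹ := by
    rw [Real.log_inv]; linarith [Real.log_nonpos hν₀.le hν₀1]
  exact creation_ledger_print_regime hℓ hprint hr hp0 hI hCn (by positivity) hK

/-- **THE LIVE LARGENESS ROW IS STILL A «`g_k` SMALL» ROW**: the §1 row holds for every
`ℓ ≥ max(1, ((1 + I₀ + C_n(3∕2 + c + (3∕2)log ν₀⁻¹))∕(λ₀²c_S))^{1∕r₀})` (`r₀, c_S, λ₀ > 0`) — ONE threshold `ℓ⋆(λ₀, ν₀)`, uniform in `k` and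
in the assignment: one `g⋆(λ₀)`, NO clause on `λ₀` (V28's `creation_ledger_print_regime_of_le` BY NAME). [folklore] -/
theorem creation_ledger_print_regime_live_of_le {ℓ p₀ p₁ r₀ I₀ Cn c cS lam0 ν₀ : ℝ} (hprint : p₀ < 2 * p₁ - 9 * r₀)
    (hr : 0 < r₀) (hp0 : 2 * r₀ + 1 ≤ p₀) (hI : 0 ≤ I₀) (hCn : 0 ≤ Cn) (hc : 0 ≤ c) (hcS : 0 < cS) (h0 : 0 < lam0)
    (hν₀ : 0 < ν₀) (hν₀1 : ν₀ ≤ 1) (hℓ1 : 1 ≤ ℓ)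
    (hℓ : ((1 + I₀ + Cn * (3 / 2 + (c + 3 / 2 * Real.log ν₀⁻¹))) / (lam0 ^ 2 * cS)) ^ (1 / r₀) ≤ ℓ) :
    ℓ ^ p₀ + I₀ + Cn * ℓ ^ (4 * r₀) * (3 / 2 * ℓ + (c + 3 / 2 * Real.log ν₀⁻¹)) ≤ (lam0 ^ 2 * cS) * ℓ ^ (2 * p₁ - 6 * r₀) := by
  have hlog : 0 ≤ Real.log ν₀⁻¹ := by
    rw [Real.log_inv]; linarith [Real.log_nonpos hν₀.le hν₀1]
  exact creation_ledger_print_regime_of_le hprint hr hp0 hI hCn (by positivity) (by positivity) hℓ1 hℓ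

/-- **THE LIVE THRESHOLD IS ABOVE THE DEAD ONE** — and that is the whole effect: for `K ≥ 0`, `C_n ≥ 0`, `c_S > 0`, `0 < λ₀ ≤ 1`,
`0 < ν₀ ≤ 1`, `r₀ > 0`: `(K∕c_S)^{1∕r₀} ≤ ((K + C_n·(3∕2)log ν₀⁻¹)∕(λ₀²c_S))^{1∕r₀}` («`g_k` small» gets smaller, uniformly). [folklore] -/
theorem threshold_live_ge {K Cn cS lam0 ν₀ r₀ : ℝ} (hK : 0 ≤ K) (hCn : 0 ≤ Cn) (hcS : 0 < cS) (h0 : 0 < lam0) (h1 : lam0 ≤ 1)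
    (hν₀ : 0 < ν₀) (hν₀1 : ν₀ ≤ 1) (hr : 0 < r₀) :
    (K / cS) ^ (1 / r₀) ≤ ((K + Cn * (3 / 2 * Real.log ν₀⁻¹)) / (lam0 ^ 2 * cS)) ^ (1 / r₀) := by
  have hlog : 0 ≤ Real.log ν₀⁻¹ := by
    rw [Real.log_inv]; linarith [Real.log_nonpos hν₀.le hν₀1]
  have hsq1 : lam0 ^ 2 ≤ 1 := by nlinarith
  have hden : 0 < lam0 ^ 2 * cS := by positivity
  have hden1 : lam0 ^ 2 * cS ≤ cS := by nlinarith
  have hstep₁ : K / cS ≤ K / (lam0 ^ 2 * cS) := div_le_div_of_nonneg_left hK hden hden1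
  have hstep₂ : K / (lam0 ^ 2 * cS) ≤ (K + Cn * (3 / 2 * Real.log ν₀⁻¹)) / (lam0 ^ 2 * cS) :=
    div_le_div_of_nonneg_right (by nlinarith) hden.le
  exact Real.rpow_le_rpow (div_nonneg hK hcS.le) (hstep₁.trans hstep₂) (by positivity)

/-- **THE JUNCTION BY VALUE — §1's ROW IMPLIES FILE 27's LIVE LEDGER.**  Under the dictionary of V28 (all (A3) readings, displayed as
hypotheses): the small factor's exponent `P ≤ ℓ^{p₀}`, the window excess `i₀ ≤ I₀`, the bond count `0 ≤ n ≤ C_n·ℓ^{4r₀}`, the window letter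
`log η⁻¹ ≤ ℓ` (window radius `≥ g_k`), V26's constant `log 160 ≤ c`, the floor `c_S·ℓ^{2p₁−6r₀} ≤ (λ∕2)δ′²`, and `ℓ ≥ 0`, the live power-counting row
`ℓ^{p₀} + I₀ + C_nℓ^{4r₀}((3∕2)ℓ + c + (3∕2)log ν₀⁻¹) ≤ λ₀²c_S·ℓ^{2p₁−6r₀}` gives the live ledger
`P + i₀ + n·((3∕2)log η⁻¹ + log 160) + n·(3∕2)log ν₀⁻¹ ≤ λ₀²·(λ∕2)δ′²` of file 27's `LiveFactorWindowRate.creationPrice_sharp_factor_le_exp_neg_live`. [folklore] -/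
theorem liveLedger_of_powerCounting {ℓ p₀ p₁ r₀ I₀ Cn c cS lam0 ν₀ P i₀ n η lam δ' : ℝ}
    (hrow : ℓ ^ p₀ + I₀ + Cn * ℓ ^ (4 * r₀) * (3 / 2 * ℓ + (c + 3 / 2 * Real.log ν₀⁻¹)) ≤
      (lam0 ^ 2 * cS) * ℓ ^ (2 * p₁ - 6 * r₀))
    (hℓ : 0 ≤ ℓ) (hP : P ≤ ℓ ^ p₀) (hi : i₀ ≤ I₀) (hn0 : 0 ≤ n) (hn : n ≤ Cn * ℓ ^ (4 * r₀)) (hη : Real.log η⁻¹ ≤ ℓ)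
    (hc : Real.log 160 ≤ c) (hν₀ : 0 < ν₀) (hν₀1 : ν₀ ≤ 1)
    (hfloor : cS * ℓ ^ (2 * p₁ - 6 * r₀) ≤ lam / 2 * δ' ^ 2) :
    P + i₀ + n * (3 / 2 * Real.log η⁻¹ + Real.log 160) + n * (3 / 2 * Real.log ν₀⁻¹) ≤ lam0 ^ 2 * (lam / 2 * δ' ^ 2) := by
  have hlog : 0 ≤ Real.log ν₀⁻¹ := by
    rw [Real.log_inv]; linarith [Real.log_nonpos hν₀.le hν₀1]
  have h160 : 0 ≤ Real.log 160 := Real.log_nonneg (by norm_num)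
  -- the bracket is nonnegative and dominates the per-bond letter
  have hbr : 3 / 2 * Real.log η⁻¹ + Real.log 160 + 3 / 2 * Real.log ν₀⁻¹ ≤ 3 / 2 * ℓ + (c + 3 / 2 * Real.log ν₀⁻¹) := by
    linarith
  have hbr0 : 0 ≤ 3 / 2 * ℓ + (c + 3 / 2 * Real.log ν₀⁻¹) := by linarith
  have h1 : n * (3 / 2 * Real.log η⁻¹ + Real.log 160) + n * (3 / 2 * Real.log ν₀⁻¹) ≤
      n * (3 / 2 * ℓ + (c + 3 / 2 * Real.log ν₀⁻¹)) := by
    have := mul_le_mul_of_nonneg_left hbr hn0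
    linarith
  have h2 : n * (3 / 2 * ℓ + (c + 3 / 2 * Real.log ν₀⁻¹)) ≤
      Cn * ℓ ^ (4 * r₀) * (3 / 2 * ℓ + (c + 3 / 2 * Real.log ν₀⁻¹)) :=
    mul_le_mul_of_nonneg_right hn hbr0
  have h3 : (lam0 ^ 2 * cS) * ℓ ^ (2 * p₁ - 6 * r₀) ≤ lam0 ^ 2 * (lam / 2 * δ' ^ 2) := by
    have := mul_le_mul_of_nonneg_left hfloor (sq_nonneg lam0)
    linarith [this, mul_assoc (lam0 ^ 2) cS (ℓ ^ (2 * p₁ - 6 * r₀))]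
  linarith

/-- **HENCE THE LIVE LEDGER BY VALUE, WITH AN EXPLICIT THRESHOLD**: under print's exponent condition, the mild rows, the dictionary of
`liveLedger_of_powerCounting`, and `ℓ ≥ max(1, ((1 + I₀ + C_n(3∕2 + c + (3∕2)log ν₀⁻¹))∕(λ₀²c_S))^{1∕r₀})`, file 27's live ledger holds for
EVERY assignment — file 26's ∕ file 27's «eventually» made an explicit `ℓ⋆(λ₀, ν₀)` in print's power-counting regime. [folklore] -/
theorem liveLedger_of_powerCounting_of_le {ℓ p₀ p₁ r₀ I₀ Cn c cS lam0 ν₀ P i₀ n η lam δ' : ℝ}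
    (hprint : p₀ < 2 * p₁ - 9 * r₀) (hr : 0 < r₀) (hp0 : 2 * r₀ + 1 ≤ p₀) (hI : 0 ≤ I₀) (hCn : 0 ≤ Cn) (hcS : 0 < cS)
    (h0 : 0 < lam0) (hν₀ : 0 < ν₀) (hν₀1 : ν₀ ≤ 1) (hℓ1 : 1 ≤ ℓ)
    (hℓ : ((1 + I₀ + Cn * (3 / 2 + (c + 3 / 2 * Real.log ν₀⁻¹))) / (lam0 ^ 2 * cS)) ^ (1 / r₀) ≤ ℓ)
    (hP : P ≤ ℓ ^ p₀) (hi : i₀ ≤ I₀) (hn0 : 0 ≤ n) (hn : n ≤ Cn * ℓ ^ (4 * r₀)) (hη : Real.log η⁻¹ ≤ ℓ)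
    (hc : Real.log 160 ≤ c) (hfloor : cS * ℓ ^ (2 * p₁ - 6 * r₀) ≤ lam / 2 * δ' ^ 2) :
    P + i₀ + n * (3 / 2 * Real.log η⁻¹ + Real.log 160) + n * (3 / 2 * Real.log ν₀⁻¹) ≤ lam0 ^ 2 * (lam / 2 * δ' ^ 2) := by
  have h160 : 0 ≤ Real.log 160 := Real.log_nonneg (by norm_num)
  have hrow := creation_ledger_print_regime_live_of_le hprint hr hp0 hI hCn (h160.trans hc) hcS h0 hν₀ hν₀1 hℓ1 hℓ
  exact liveLedger_of_powerCounting hrow (by linarith) hP hi hn0 hn hη hc hν₀ hν₀1 hfloor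

/-! ## §1b (v1.2) V28 §4's ledger AT ANY RATE `r` ∕ the `SU(N)` instance at live letters: the rate moves the ONE largeness row, nothing else -/

/-- **THE CREATION LEDGER AT ANY RATE, LIVE** (`d = 4`, MODEL): V28 v2's `creation_ledger_print_regime_rate` at `c := c + r·log ν₀⁻¹`,
`c_S := λ₀²c_S` — under print's «`2p₁ − 9r₀ > p₀`», the mild rows, constants `I₀, C_n, c, r ≥ 0`, `0 < ν₀ ≤ 1` and the LIVE largeness row
`1 + I₀ + C_n·(r + (c + r·log ν₀⁻¹)) ≤ λ₀²c_S·ℓ^{r₀}`: `ℓ^{p₀} + I₀ + C_n·ℓ^{4r₀}·(r·ℓ + (c + r·log ν₀⁻¹)) ≤ λ₀²c_S·ℓ^{2p₁ − 6r₀}` — the SAME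
exponents at every rate; the live factor's summand `r·log ν₀⁻¹` (file 27 §0 ∕ file 30) joins the constant. [folklore] -/
theorem creation_ledger_print_regime_rate_live {ℓ p₀ p₁ r₀ I₀ Cn c cS r lam0 ν₀ : ℝ} (hℓ : 1 ≤ ℓ)
    (hprint : p₀ < 2 * p₁ - 9 * r₀) (hr₀ : 0 ≤ r₀) (hp0 : 2 * r₀ + 1 ≤ p₀) (hI : 0 ≤ I₀) (hCn : 0 ≤ Cn) (hc : 0 ≤ c) (hr : 0 ≤ r)
    (hν₀ : 0 < ν₀) (hν₀1 : ν₀ ≤ 1)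
    (hK : 1 + I₀ + Cn * (r + (c + r * Real.log ν₀⁻¹)) ≤ (lam0 ^ 2 * cS) * ℓ ^ r₀) :
    ℓ ^ p₀ + I₀ + Cn * ℓ ^ (4 * r₀) * (r * ℓ + (c + r * Real.log ν₀⁻¹)) ≤ (lam0 ^ 2 * cS) * ℓ ^ (2 * p₁ - 6 * r₀) := by
  have hlog : 0 ≤ Real.log ν₀⁻¹ := by
    rw [Real.log_inv]; linarith [Real.log_nonpos hν₀.le hν₀1]
  exact creation_ledger_print_regime_rate hℓ hprint hr₀ hp0 hI hCn (by positivity) hr hK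

/-- The same with the live largeness row discharged by the explicit threshold
`ℓ ≥ max(1, ((1 + I₀ + C_n(r + c + r·log ν₀⁻¹))∕(λ₀²c_S))^{1∕r₀})` (`r₀, c_S, λ₀ > 0`) — ONE `ℓ⋆(λ₀, ν₀; r)`, `k`-uniform, NO clause on `λ₀`
(V28's `creation_ledger_print_regime_rate_of_le` BY NAME). [folklore] -/
theorem creation_ledger_print_regime_rate_live_of_le {ℓ p₀ p₁ r₀ I₀ Cn c cS r lam0 ν₀ : ℝ} (hprint : p₀ < 2 * p₁ - 9 * r₀)
    (hr₀ : 0 < r₀) (hp0 : 2 * r₀ + 1 ≤ p₀) (hI : 0 ≤ I₀) (hCn : 0 ≤ Cn) (hc : 0 ≤ c) (hr : 0 ≤ r) (hcS : 0 < cS) (h0 : 0 < lam0)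
    (hν₀ : 0 < ν₀) (hν₀1 : ν₀ ≤ 1) (hℓ1 : 1 ≤ ℓ)
    (hℓ : ((1 + I₀ + Cn * (r + (c + r * Real.log ν₀⁻¹))) / (lam0 ^ 2 * cS)) ^ (1 / r₀) ≤ ℓ) :
    ℓ ^ p₀ + I₀ + Cn * ℓ ^ (4 * r₀) * (r * ℓ + (c + r * Real.log ν₀⁻¹)) ≤ (lam0 ^ 2 * cS) * ℓ ^ (2 * p₁ - 6 * r₀) := by
  have hlog : 0 ≤ Real.log ν₀⁻¹ := by
    rw [Real.log_inv]; linarith [Real.log_nonpos hν₀.le hν₀1]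
  exact creation_ledger_print_regime_rate_of_le hprint hr₀ hp0 hI hCn (by positivity) hr (by positivity) hℓ1 hℓ

/-- **THE `SU(N)` INSTANCE, LIVE**: at the rate `r = (N² − 1)∕2 = ½·dim SU(N)` of V29 ∕ V38 (file 30's live summand `((N² − 1)∕2)·log ν₀⁻¹`),
print's regime closes the live creation ledger once `ℓ ≥ max(1, ((1 + I₀ + C_n((N² − 1)∕2 + c + ((N² − 1)∕2)·log ν₀⁻¹))∕(λ₀²c_S))^{1∕r₀})` —
for every `N` the live factor is one moved largeness row (V28's `creation_ledger_print_regime_SUN` at live constants). [folklore] -/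
theorem creation_ledger_print_regime_SUN_live (N : ℕ) {ℓ p₀ p₁ r₀ I₀ Cn c cS lam0 ν₀ : ℝ} (hprint : p₀ < 2 * p₁ - 9 * r₀)
    (hr₀ : 0 < r₀) (hp0 : 2 * r₀ + 1 ≤ p₀) (hI : 0 ≤ I₀) (hCn : 0 ≤ Cn) (hc : 0 ≤ c) (hcS : 0 < cS) (h0 : 0 < lam0)
    (hν₀ : 0 < ν₀) (hν₀1 : ν₀ ≤ 1) (hℓ1 : 1 ≤ ℓ)
    (hℓ : ((1 + I₀ + Cn * (((N ^ 2 - 1 : ℕ) : ℝ) / 2 + (c + ((N ^ 2 - 1 : ℕ) : ℝ) / 2 * Real.log ν₀⁻¹))) / (lam0 ^ 2 * cS)) ^ (1 / r₀) ≤ ℓ) :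
    ℓ ^ p₀ + I₀ + Cn * ℓ ^ (4 * r₀) * (((N ^ 2 - 1 : ℕ) : ℝ) / 2 * ℓ + (c + ((N ^ 2 - 1 : ℕ) : ℝ) / 2 * Real.log ν₀⁻¹))
      ≤ (lam0 ^ 2 * cS) * ℓ ^ (2 * p₁ - 6 * r₀) :=
  creation_ledger_print_regime_rate_live_of_le hprint hr₀ hp0 hI hCn hc (by positivity) hcS h0 hν₀ hν₀1 hℓ1 hℓ

/-! ## §2 Print's (1.77)∕(1.78) floor at a LIVE event: the `p₁²`-power is scaled, the `O(1)` constant is not -/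

/-- **THE LIVE FLOOR EXPONENT IN PRINT'S LETTERS**: for `γ₀ ≥ 0`, `W > 0`, `0 ≤ λ₀ ≤ s`:
`i₀ + c − γ₀W⁻¹(s·A₁p₁)² ≤ i₀ + c − λ₀²·γ₀W⁻¹(A₁p₁)²` — (1.77)'s constant `c` rides unscaled. [folklore] -/
theorem print_exponent_live_le {i₀ c γ₀ Wc A₁ p₁ s lam0 : ℝ} (hγ₀ : 0 ≤ γ₀) (hWc : 0 < Wc) (h0 : 0 ≤ lam0) (hs : lam0 ≤ s) :
    i₀ + c - γ₀ * Wc⁻¹ * ((s * A₁) * p₁) ^ 2 ≤ i₀ + c - lam0 ^ 2 * (γ₀ * Wc⁻¹ * (A₁ * p₁) ^ 2) := by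
  have hsq : lam0 ^ 2 ≤ s ^ 2 := pow_le_pow_left₀ h0 hs 2
  have hnn : 0 ≤ γ₀ * Wc⁻¹ * (A₁ * p₁) ^ 2 := by
    have : 0 ≤ Wc⁻¹ := (inv_pos.2 hWc).le
    positivity
  have h := mul_le_mul_of_nonneg_right hsq hnn
  have e : γ₀ * Wc⁻¹ * ((s * A₁) * p₁) ^ 2 = s ^ 2 * (γ₀ * Wc⁻¹ * (A₁ * p₁) ^ 2) := by ring
  rw [e]; linarith

section Printed

variable {K Y B : Type*} [MeasurableSpace K] [MeasurableSpace Y] (κ : Measure K) (μ : Measure Y)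
variable [Group K] [MeasurableMul K] [κ.IsMulLeftInvariant] [SFinite κ] [SFinite μ]

/-- **THE (n)-CARRIER'S PRICE WITH PRINT'S (1.77)∕(1.78) FLOOR AT A LIVE EVENT** (V24's `relFibre_moment_le_of_ineq177_178` BY NAME).
Road (δ) lowers the large-field threshold of [Balaban1989LargeFieldII] p. 383 «we take the bond `b`, for which `|B(b)| ≧ g_j⁻¹δ′_j = A₁p₁(g_j)`»
to `s·A₁p₁(g_j)`, `s ∈ [λ₀, 1]` (`h78`'s event conjunct `(s·A₁p₁)² ≤ nb`); every other hypothesis verbatim (window `W`, (1.77)'s shape with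
its constant `c`, (1.78)'s `W`-inequality).  Then for EVERY such `s`:
`∫ F·w·e^{−I} ≤ e^{i₀ + c − λ₀²·γ₀W⁻¹(A₁p₁)²}·(∫F dκ ∕ κ(W))·∫ G·w·e^{−I}` — ONE price for the grid; the `p₁²`-power × `λ₀²` (census row 1),
the `O(1)` constant `c` unscaled. [folklore] -/
theorem relFibre_moment_le_of_ineq177_178_live (F G : K → ℝ) (w : Y → ℝ) (I : K × Y → ℝ) (m₀ : Y → ℝ) (U₀ : Y → K)
    (W : Set K) (s𝔹 : Finset B) (Q ndB : Y → K → ℝ) (nb : Y → K → B → ℝ) {i₀ γ₀ Wc c A₁ p₁ s lam0 : ℝ}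
    (hF0 : ∀ x, 0 ≤ F x) (hG0 : ∀ x, 0 ≤ G x) (hw0 : ∀ y, 0 ≤ w y) (hW : MeasurableSet W) (hWpos : 0 < κ.real W)
    (hγ₀ : 0 ≤ γ₀) (hWc : 0 < Wc) (h0 : 0 ≤ lam0) (hs : lam0 ≤ s)
    (hQ : ∀ x y, F x ≠ 0 → w y ≠ 0 → m₀ y + Q y x ≤ I (x, y))
    (h77 : ∀ x y, F x ≠ 0 → w y ≠ 0 → γ₀ * ndB y x - c < Q y x)
    (h78 : ∀ x y, F x ≠ 0 → w y ≠ 0 → ∃ b ∈ s𝔹, nb y x b ≤ Wc * ndB y x ∧ (s * (A₁ * p₁)) ^ 2 ≤ nb y x b)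
    (hGwin : ∀ y v, w y ≠ 0 → v ∈ W → 1 ≤ G (U₀ y * v))
    (hIrel : ∀ y v, w y ≠ 0 → v ∈ W → I (U₀ y * v, y) ≤ m₀ y + i₀)
    (hFi : Integrable F κ) (hGI : ∀ y, w y ≠ 0 → Integrable (fun x => G x * exp (-I (x, y))) κ)
    (hA' : Integrable (fun z : K × Y => F z.1 * w z.2 * exp (-I z)) (κ.prod μ))
    (hB' : Integrable (fun z : K × Y => G z.1 * w z.2 * exp (-I z)) (κ.prod μ)) :
    ∫ z, F z.1 * w z.2 * exp (-I z) ∂(κ.prod μ) ≤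
      (exp (i₀ + c - lam0 ^ 2 * (γ₀ * Wc⁻¹ * (A₁ * p₁) ^ 2)) * ((∫ x, F x ∂κ) / κ.real W)) *
        ∫ z, G z.1 * w z.2 * exp (-I z) ∂(κ.prod μ) := by
  -- V24's price with the event at the lowered threshold, read with `A₁ := s·A₁`
  have h78' : ∀ x y, F x ≠ 0 → w y ≠ 0 → ∃ b ∈ s𝔹, nb y x b ≤ Wc * ndB y x ∧ ((s * A₁) * p₁) ^ 2 ≤ nb y x b := by
    intro x y hx hy
    obtain ⟨b, hb, h1, h2⟩ := h78 x y hx hy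
    exact ⟨b, hb, h1, by simpa [mul_assoc] using h2⟩
  have key := relFibre_moment_le_of_ineq177_178 κ μ F G w I m₀ U₀ W s𝔹 Q ndB nb (A₁ := s * A₁) hF0 hG0 hw0 hW hWpos hγ₀ hWc
    hQ h77 h78' hGwin hIrel hFi hGI hA' hB'
  -- the nonnegative factors and the exponent comparison
  have hV : 0 ≤ (∫ x, F x ∂κ) / κ.real W := div_nonneg (integral_nonneg hF0) hWpos.le
  have hint : 0 ≤ ∫ z, G z.1 * w z.2 * exp (-I z) ∂(κ.prod μ) :=
    integral_nonneg fun z => mul_nonneg (mul_nonneg (hG0 _) (hw0 _)) (exp_pos _).le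
  have hexp := Real.exp_le_exp.2 (print_exponent_live_le (i₀ := i₀) (c := c) (A₁ := A₁) (p₁ := p₁) hγ₀ hWc h0 hs)
  exact key.trans (mul_le_mul_of_nonneg_right (mul_le_mul_of_nonneg_right hexp hV) hint)

end Printed

/-! ## §3 Sanity -/

/-- Decided toy for §1 with no volume debit and no excess (`C_n = I₀ = 0`), `r₀ = 0`, `p₀ = p₁ = 1`, `c_S = 1`, `λ₀ = ν₀ = 1`, `ℓ = 2`:
print's condition `1 < 2`, the live largeness row `1 ≤ 1·2⁰`, and the row reads `2¹ ≤ 2²`. -/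
example : (2 : ℝ) ^ (1 : ℝ) + 0 + 0 * (2 : ℝ) ^ (4 * (0 : ℝ)) * (3 / 2 * 2 + (0 + 3 / 2 * Real.log (1 : ℝ)⁻¹)) ≤
    ((1 : ℝ) ^ 2 * 1) * (2 : ℝ) ^ (2 * (1 : ℝ) - 6 * 0) :=
  creation_ledger_print_regime_live (ν₀ := 1) (by norm_num) (by norm_num) le_rfl (by norm_num) le_rfl le_rfl le_rfl one_pos le_rfl
    (by rw [Real.rpow_zero]; norm_num)

end Summit.QuantumFields.BalabanUV.T4Continuum.Spine.NE7c.LiveFactorCreationLedger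

end
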